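import Literature.MathematicalPhysics.KineticTheory.EvenCollisionTubeFunctional
import Summits.AtomisticToContinuum.HydrodynamicLimit.Theorems.EvenStressEnskog.Negative.ContactValueZero
import Summits.AtomisticToContinuum.HydrodynamicLimit.Theses.TwoClocks
import HarnessLib

/-!
# The capped contact value of the D₂ compensator (helpers `ccb6_*` of the line `birth`, crux
# `TwoClocks.EquilibriumFastWindowLD`, stmt-AtomisticToContinuum-14440)

The registered stub `stub_partnerInnovationPressure` (D₂, rev 5) weights its local Enskog compensator by
`Y η = (hsCompressibility (min η (8σ³)) - 1) / (2/3 · π · min η (8σ³))`, the contact value of the hard-sphere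
pair correlation at the local empirical reduced density capped at `8σ³` (virial theorem
`Z(η) = 1 + (2π/3) η g(1⁺)`). This file records the two facts about `Y` a proof of D₂ consumes:

* `ccb6_capY_eq_contactValue` — for EVERY real `x`, `(Z(x) - 1)/((2π/3) x)` is the tree's thermodynamic contact
  value `contactValue x = (3/2π) f_ex′(x)` (`Literature/MathematicalPhysics/KineticTheory/EvenCollisionTubeFunctional`);
  at `x = 0` both sides are the junk `0` (`0/0 = 0` on the left, `deriv hsExcessFreeEnergy 0 = 0` on the right,
  `EvenStressEnskog.deriv_hsExcessFreeEnergy_zero`). Hence `Y = contactValue ∘ (min · (8σ³))`, so that the tree's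
  `CollisionRate.contactValue_regular` (bounded on `[0, η₁/2]`, continuous on `(0, η₁)`) and the virial theorem
  `contactValue_eq_contactG` (`StatisticalMechanics/HardSphereContactTheoremProofs`) apply verbatim to `Y`;
* `ccb6_contactValue_tendsto_one` — the physical right limit `Y(0⁺) = 1` from the PROVED equation of state
  `TwoClocks.HsEosLowDensity_holds` (`f_ex = F` on `[0, η₀)`, `F` analytic, `F′(0) = 2π/3`): on `(0, η₀)` the
  `deriv`-junk is never met, `contactValue = (3/2π) F′`, and `F′` is continuous at `0`. (This limit is the
  hypothesis `hlim` of `EvenStressEnskog.not_continuousWithinAt_contactValue`; it was not yet a tree theorem.)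

References: J.-P. Hansen, I. R. McDonald, *Theory of Simple Liquids* (2013) §2.5 (virial theorem, contact value);
D. Ruelle, *Statistical Mechanics* (1969) §3.4, §4.2 (low-density equation of state).
-/

noncomputable section

open Filter Set Topology

namespace Summit.AtomisticToContinuum.HydrodynamicLimit.Theorems.ClampedCorrectorBirth

open Literature.MathematicalPhysics.KineticTheory
open Summit.AtomisticToContinuum.HydrodynamicLimit.Theorems.EvenStressEnskog (deriv_hsExcessFreeEnergy_zero)
open Summit.AtomisticToContinuum.HydrodynamicLimit.Theses.TwoClocks (HsEosLowDensity_holds)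

/-- **The D₂ contact-value weight is the tree's `contactValue`, everywhere.** For every real `x`,
`(Z(x) - 1)/((2π/3) x) = (3/2π) f_ex′(x)`: for `x ≠ 0` this is the algebra `Z = 1 + x f_ex′(x)`; at `x = 0`
both sides are `0` (`0/0 = 0`; `deriv hsExcessFreeEnergy 0 = 0`). In particular the capped weight of D₂ is
`contactValue (min η (8σ³))`. -/
theorem ccb6_capY_eq_contactValue :
    ∀ x : ℝ, (hsCompressibility x - 1) / (2 / 3 * Real.pi * x) = contactValue x := by
  intro x
  unfold hsCompressibility contactValue
  by_cases hx : x = 0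
  · subst hx
    simp [deriv_hsExcessFreeEnergy_zero]
  · field_simp
    ring

/-- **The contact value tends to `1` at zero density** (`Y(0⁺) = 1`, second virial coefficient): from the
proved low-density equation of state `HsEosLowDensity_holds`, on `(0, η₀)` one has
`contactValue = (3/2π) F′` with `F` analytic on `(-η₀, η₀)` and `F′(0) = 2π/3`. -/
theorem ccb6_contactValue_tendsto_one :
    Filter.Tendsto contactValue (nhdsWithin (0 : ℝ) (Set.Ioi 0)) (nhds 1) := by
  obtain ⟨η₀, hη₀, F, hF, hEq, -, hF'0, -⟩ := HsEosLowDensity_holds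
  have h0 : (0 : ℝ) ∈ Ioo (-η₀) η₀ := ⟨by linarith, hη₀⟩
  have hcont : ContinuousAt (deriv F) 0 := (hF.deriv 0 h0).continuousAt
  have h1 : Tendsto (fun η : ℝ => 3 / (2 * Real.pi) * deriv F η) (nhdsWithin (0 : ℝ) (Ioi 0))
      (nhds (3 / (2 * Real.pi) * deriv F 0)) :=
    (hcont.tendsto.mono_left nhdsWithin_le_nhds).const_mul _
  have hlim : 3 / (2 * Real.pi) * deriv F 0 = 1 := by
    rw [hF'0]
    field_simp
  rw [hlim] at h1
  refine h1.congr' ?_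
  filter_upwards [Ioo_mem_nhdsGT hη₀] with η hη
  have hnhds : hsExcessFreeEnergy =ᶠ[𝓝 η] F :=
    (hEq.mono Ioo_subset_Ico_self).eventuallyEq_of_mem (isOpen_Ioo.mem_nhds hη)
  rw [contactValue, hnhds.deriv_eq]

end Summit.AtomisticToContinuum.HydrodynamicLimit.Theorems.ClampedCorrectorBirth

end
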